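import Literature.Analysis.FluidPDE.ElgindiAngularWeightedBounds
import HarnessLib

/-!
# The level-`k` angular integration by parts of Elgindi's `𝓗ᵏ` elliptic estimates
([Elgindi2021] §7.3 Steps 4–5, §7.4 Proposition 7.9; [ElgindiGhoulMasmoudi2021] §6 Theorem 3)

Topic `Literature/Analysis/FluidPDE`. Proof file (everything proved, no definitions, no named
facts) on the proof path of the named fact
`Literature.Analysis.FluidPDE.Elgindi.ElgindiGhoulMasmoudi2021_stabilityCore`
(`ElgindiStabilityDecomposition.lean`). T. M. Elgindi, Ann. of Math. 194 (2021) =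
arXiv:1904.04795, §7.4, proof of Proposition 7.9 (p. 23 of the held text):

> "By induction on `k`, it suffices to consider only the following three terms:
> `½∫∂_θ^{k+1}Ψ̃ ∂_θ^{k+2}Ψ̃ sin(2θ)^{2k+1−γ} − (k+2)∫sin²(θ)(∂_θ^{k+1}Ψ̃)² sin(2θ)^{2k−γ} + […]`
> `= ((2k+1−γ)/4)∫(∂_θ^{k+1}Ψ̃)² cos(2θ) sin(2θ)^{2k−γ} − (k+2)∫sin²(θ)(∂_θ^{k+1}Ψ̃)² sin(2θ)^{2k−γ} […] + E`"

(the same computation as Step 4 of Proposition 7.7 for `k = 1`, "−¼sin(2θ)^{3−γ}∂_θ((∂_θ²Ψ̄)²) […]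
= ((3−γ)/2)cos(2θ)[…]", and as [ElgindiGhoulMasmoudi2021] §6). The only integration by parts of the
level-`k` argument is the one turning `∂^{k+1}Ψ̃·∂^{k+2}Ψ̃·sin(2θ)^{2k+1−γ}` into
`(∂^{k+1}Ψ̃)²cos(2θ)sin(2θ)^{2k−γ}`; with the weight exponent `r = 2k − γ ≥ 0` it is an ORDINARY
integration by parts on `[0, π/2]` (the boundary function `½sin(2θ)^{r+1}g²` vanishes at both ends,
no Dirichlet data needed):

* `integral_Ioo_sin_rpow_succ_mul_mul_deriv`: **`∫₀^{π/2} sin(2θ)^{r+1} g g′ = −(r+1)∫₀^{π/2} cos(2θ) sin(2θ)^r g²`**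
  for `g ∈ C¹(ℝ)` and `r ≥ 0`;
* `continuous_sin_two_mul_rpow`: the level weights `sin(2θ)^r`, `r ≥ 0`, are continuous on `ℝ`, and
  `sin_two_mul_rpow_le_rpow`: `sin(2θ)^{r'} ≤ sin(2θ)^r` on `(0, π/2)` for `r ≤ r'` (the weights
  decrease with the level).
-/

noncomputable section

open MeasureTheory Set Real Filter intervalIntegral
open _root_.Topology

namespace Literature.Analysis.FluidPDE

namespace Elgindi

/-! ### The level weights -/

/-- `sin(2θ)^r` is continuous on `ℝ` for `r ≥ 0`. [folklore] -/
theorem continuous_sin_two_mul_rpow {r : ℝ} (hr : 0 ≤ r) : Continuous fun θ : ℝ => Real.sin (2 * θ) ^ r :=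
  (by fun_prop : Continuous fun θ : ℝ => Real.sin (2 * θ)).rpow_const fun _ => Or.inr hr

/-- The level weights decrease with the level: `sin(2θ)^{r'} ≤ sin(2θ)^r` on `(0, π/2)` for `r ≤ r'`.
[folklore] -/
theorem sin_two_mul_rpow_le_rpow {r r' : ℝ} (h : r ≤ r') {θ : ℝ} (hθ : θ ∈ Ioo 0 (π / 2)) :
    Real.sin (2 * θ) ^ r' ≤ Real.sin (2 * θ) ^ r := by
  have hs : 0 < Real.sin (2 * θ) := Real.sin_pos_of_pos_of_lt_pi (by linarith [hθ.1]) (by linarith [hθ.2])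
  exact Real.rpow_le_rpow_of_exponent_ge hs (Real.sin_le_one _) h

/-- `0 ≤ sin(2θ)^r` on `(0, π/2)`. [folklore] -/
theorem sin_two_mul_rpow_nonneg (r : ℝ) {θ : ℝ} (hθ : θ ∈ Ioo 0 (π / 2)) : 0 ≤ Real.sin (2 * θ) ^ r :=
  Real.rpow_nonneg (Real.sin_pos_of_pos_of_lt_pi (by linarith [hθ.1]) (by linarith [hθ.2])).le _

/-- `sin(2θ)^r ≤ 1` on `(0, π/2)` for `r ≥ 0`. [folklore] -/
theorem sin_two_mul_rpow_le_one {r : ℝ} (hr : 0 ≤ r) {θ : ℝ} (hθ : θ ∈ Ioo 0 (π / 2)) : Real.sin (2 * θ) ^ r ≤ 1 := by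
  have hs : 0 < Real.sin (2 * θ) := Real.sin_pos_of_pos_of_lt_pi (by linarith [hθ.1]) (by linarith [hθ.2])
  exact Real.rpow_le_one hs.le (Real.sin_le_one _) hr

/-! ### The level-`k` integration by parts -/

/-- **`∫₀^{π/2} sin(2θ)^{r+1} g g′ = −(r+1)∫₀^{π/2} cos(2θ) sin(2θ)^r g²`** for `g ∈ C¹(ℝ)` and `r ≥ 0`
(boundary function `½sin(2θ)^{r+1}g²`, vanishing at `0` and `π/2`).
[cite: Elgindi2021, §7.4 proof of Proposition 7.9, display "= ((2k+1−γ)/4)∫(∂_θ^{k+1}Ψ̃)²cos(2θ)sin(2θ)^{2k−γ} …" (p. 23 of arXiv:1904.04795)] -/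
theorem integral_Ioo_sin_rpow_succ_mul_mul_deriv {r : ℝ} (hr : 0 ≤ r) {g : ℝ → ℝ} (hg : ContDiff ℝ 1 g) :
    ∫ θ in Ioo 0 (π / 2), Real.sin (2 * θ) ^ (r + 1) * g θ * deriv g θ =
      -(r + 1) * ∫ θ in Ioo 0 (π / 2), Real.cos (2 * θ) * Real.sin (2 * θ) ^ r * g θ ^ 2 := by
  have hb : (0 : ℝ) ≤ π / 2 := by positivity
  have hd : Differentiable ℝ g := hg.differentiable (by simp)
  have hgc : Continuous g := hg.continuous
  have hdc : Continuous (deriv g) := hg.continuous_deriv le_rfl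
  have cr : Continuous fun θ : ℝ => Real.sin (2 * θ) ^ r := continuous_sin_two_mul_rpow hr
  have cr1 : Continuous fun θ : ℝ => Real.sin (2 * θ) ^ (r + 1) := continuous_sin_two_mul_rpow (by linarith)
  -- the boundary function and its derivative (everywhere: the exponent `r + 1 ≥ 1`)
  have hderiv : ∀ θ : ℝ, HasDerivAt (fun θ => (1 / 2) * Real.sin (2 * θ) ^ (r + 1) * g θ ^ 2)
      ((r + 1) * (Real.cos (2 * θ) * Real.sin (2 * θ) ^ r * g θ ^ 2) + Real.sin (2 * θ) ^ (r + 1) * g θ * deriv g θ) θ := by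
    intro θ
    have h2 : HasDerivAt (fun x : ℝ => 2 * x) 2 θ := by simpa using (hasDerivAt_id' θ).const_mul (2 : ℝ)
    have hS : HasDerivAt (fun x => Real.sin (2 * x)) (Real.cos (2 * θ) * 2) θ := h2.sin
    have hU : HasDerivAt (fun x => Real.sin (2 * x) ^ (r + 1)) (Real.cos (2 * θ) * 2 * (r + 1) * Real.sin (2 * θ) ^ (r + 1 - 1)) θ :=
      hS.rpow_const (Or.inr (by linarith))
    have e2 : (fun y => g y ^ 2) = fun y => g y * g y := by funext y; ring
    have hP : HasDerivAt (fun y => g y ^ 2) (deriv g θ * g θ + g θ * deriv g θ) θ := by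
      rw [e2]; exact (hd θ).hasDerivAt.fun_mul (hd θ).hasDerivAt
    have hall := ((hU.const_mul (1 / 2 : ℝ)).fun_mul hP)
    refine hall.congr_deriv ?_
    rw [show r + 1 - 1 = r by ring]
    ring
  -- the fundamental theorem of calculus on `[0, π/2]`
  have hcont : Continuous fun θ => (r + 1) * (Real.cos (2 * θ) * Real.sin (2 * θ) ^ r * g θ ^ 2) +
      Real.sin (2 * θ) ^ (r + 1) * g θ * deriv g θ := by
    have := cr; have := cr1; fun_prop
  have hFTC := integral_eq_sub_of_hasDerivAt (a := 0) (b := π / 2) (fun θ _ => hderiv θ) (hcont.intervalIntegrable _ _)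
  have hr1 : r + 1 ≠ 0 := by linarith
  have e0 : (1 / 2 : ℝ) * Real.sin (2 * 0) ^ (r + 1) * g 0 ^ 2 = 0 := by simp [Real.zero_rpow hr1]
  have eπ : (1 / 2 : ℝ) * Real.sin (2 * (π / 2)) ^ (r + 1) * g (π / 2) ^ 2 = 0 := by
    rw [show 2 * (π / 2) = π by ring, Real.sin_pi, Real.zero_rpow hr1]; ring
  rw [e0, eπ, sub_zero] at hFTC
  -- split the integral of the derivative
  have i1 : IntervalIntegrable (fun θ => (r + 1) * (Real.cos (2 * θ) * Real.sin (2 * θ) ^ r * g θ ^ 2)) volume 0 (π / 2) := by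
    have := cr; exact (by fun_prop : Continuous fun θ => (r + 1) * (Real.cos (2 * θ) * Real.sin (2 * θ) ^ r * g θ ^ 2)).intervalIntegrable _ _
  have i2 : IntervalIntegrable (fun θ => Real.sin (2 * θ) ^ (r + 1) * g θ * deriv g θ) volume 0 (π / 2) := by
    have := cr1; exact (by fun_prop : Continuous fun θ => Real.sin (2 * θ) ^ (r + 1) * g θ * deriv g θ).intervalIntegrable _ _
  rw [intervalIntegral.integral_add i1 i2, intervalIntegral.integral_const_mul, intervalIntegral.integral_of_le hb,
    intervalIntegral.integral_of_le hb, integral_Ioc_eq_integral_Ioo, integral_Ioc_eq_integral_Ioo] at hFTC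
  linarith

end Elgindi

end Literature.Analysis.FluidPDE
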